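import Summits.ResolutionOfSingularities.ResolutionOfSingularities.Theorems.HilbertSamuelEliminationSigmaMaxModificationsCorridor3TameWildNuModPackaging
import Summits.ResolutionOfSingularities.ResolutionOfSingularities.Theorems.HilbertSamuelEliminationSigmaMaxModificationsCorridor3NuModTransitivity
import Mathlib.AlgebraicGeometry.Morphisms.Proper
import HarnessLib

/-!
# Route `HilbertSamuelElimination`, crux `SigmaMaxModificationsCorridor3`
# (stmt-ResolutionOfSingularities-19249; child of `SigmaMaxModifications` stmt-…-18506),
# line `tame_wild` v3 (confined form) — SET-UP on top of a confining sequence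

[OURS · L1 W4.2] First step of the assembly of the registered stubs `stub_confinedTameNu3_of_thor4` /
`stub_confinedWildNu3` (lead's helpers-v3 §Assembly): given a blow-up sequence `s : CentreSeq Y` with
centres over `Y(ν)` along which `H^N` does not increase (`ν` maximal, `Y` reduced, locally of finite
type and quasi-compact over a field, `dim Y ≤ d, ≤ N`), EITHER `ν` is already dead on `s.top` — and
then `s` itself is the `ν`-modification (landed `nuMod_of_centreSeq`, p460155) — OR `ν` is maximal in
`Σ_{s.top}(N)` (landed `not_mem_hsValues_or_maximal_of_hsFun_le`, p475565) and its stratum on `s.top`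
is CLOSED (sharp semicontinuity over a field at `N ≥ dim`, landed `stub_isClosed_hsMaxLocus_over_field`),
so that its complement `Zc` is the open over which the chart witnesses are glued with the identity;
moreover `s.top` is again reduced, locally of finite type and quasi-compact over `k`, of dimension
`≤ d, ≤ N`. NOT a statement of any manuscript.

## Sources

* V. Cossart, U. Jannsen, S. Saito, LNM 2270 (2020), Def. 2.28, Thm. 2.33, Def. 6.14, Rem. 6.24.
  [CossartJannsenSaito2020]
-/

set_option linter.dupNamespace false -- mandated namespace of this single-conjunct summit

noncomputable section

open CategoryTheory AlgebraicGeometry TopologicalSpace Topology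
open Literature.AlgebraicGeometry.Resolution Literature.RingTheory.HilbertSamuel
open Summit.ResolutionOfSingularities.ResolutionOfSingularities.Theorems.SigmaMaxModifications.Sketch

namespace Summit.ResolutionOfSingularities.ResolutionOfSingularities.Theorems.SigmaMaxModificationsCorridor3.TameWild

/-- **Set-up on top of a confining sequence.** For `Y` reduced, locally of finite type and
quasi-compact over a field `k`, `dim Y ≤ d`, `dim Y ≤ N`, `ν` maximal in `Σ_Y(N)`, and a blow-up
sequence `s` with centres over `Y(ν)` along which `H^N` does not increase: either `NuMod Y N d ν`
holds already (witnessed by `s`), or `ν` is maximal in `Σ_{s.top}(N)`, the stratum `s.top(ν)` is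
closed, and `s.top` is reduced of dimension `≤ d`, `≤ N`, with `s.comp ≫ g` locally of finite type
and quasi-compact. [cite: CossartJannsenSaito2020, Def. 6.14, Rem. 6.24, Thm. 2.33] -/
theorem nuMod_or_setup_top {k : Type} [Field k] {Y : Scheme.{0}} (g : Y ⟶ Spec (.of k))
    [LocallyOfFiniteType g] [QuasiCompact g] [IsReduced Y] {N d : ℕ}
    (hdimd : topologicalKrullDim Y ≤ (d : WithBot ℕ∞))
    (hdimN : topologicalKrullDim Y ≤ (N : WithBot ℕ∞)) {ν : ℕ → ℕ}
    (hν : Maximal (· ∈ Scheme.hsValues Y N) ν) (s : CentreSeq Y)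
    (hover : s.CentresOver (Scheme.hsStratum Y N ν))
    (hmono : ∀ x' : s.top, Scheme.hsFun s.top N x' ≤ Scheme.hsFun Y N (s.comp.base x')) :
    NuMod Y N d ν ∨
      (Maximal (· ∈ Scheme.hsValues s.top N) ν ∧ IsClosed (Scheme.hsStratum s.top N ν) ∧
        IsReduced s.top ∧ topologicalKrullDim s.top ≤ (d : WithBot ℕ∞) ∧
        topologicalKrullDim s.top ≤ (N : WithBot ℕ∞) ∧ LocallyOfFiniteType (s.comp ≫ g) ∧
        QuasiCompact (s.comp ≫ g)) := by
  haveI : IsLocallyNoetherian Y := LocallyOfFiniteType.isLocallyNoetherian g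
  rcases not_mem_hsValues_or_maximal_of_hsFun_le N ν s.comp hmono hν with hkill | hmax
  · exact Or.inl (nuMod_of_centreSeq hdimd hdimN s hover hmono hkill)
  · right
    obtain ⟨hprop, hsred, hsdimd, -, -⟩ :=
      stub_centreSeq_package Y d hdimd (Scheme.hsStratum Y N ν) s hover
    have hsdimN : topologicalKrullDim s.top ≤ (N : WithBot ℕ∞) := topologicalKrullDim_top_le s hdimN
    haveI := hprop
    haveI := hsred
    haveI : LocallyOfFiniteType (s.comp ≫ g) := inferInstance
    haveI : QuasiCompact (s.comp ≫ g) := inferInstance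
    have husc : ∀ μ : ℕ → ℕ, IsClosed (Scheme.hsStratumGE s.top N μ) :=
      (stub_isClosed_hsMaxLocus_over_field stub_hsFun_le_of_specializes_over_field k s.top
        (s.comp ≫ g) inferInstance inferInstance N hsdimN).1
    exact ⟨hmax, Scheme.isClosed_hsStratum_of_maximal husc hmax, hsred, hsdimd, hsdimN,
      inferInstance, inferInstance⟩

/-- **The traces of a confined stratum on separated charts are disjoint.** If the stratum
`S' ⊆ X'` maps into the finite set `A ⊆ X` under `f`, and the opens `U₁, U₂ ⊆ X` meet `A` only in
the distinct points `y₁ ≠ y₂` (`Uᵢ ∩ A ⊆ {yᵢ}`), then `f⁻¹U₁ ∩ f⁻¹U₂` misses `S'` — the hypothesis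
shape `U₁ ⊓ U₂ ≤ Zc` of the two-chart merge `exists_localWitness_sup` (p478407). [folklore] -/
theorem preimage_inter_preimage_subset_compl {X' X : Type} (f : X' → X) (S' : Set X') (A : Set X)
    (hS : f '' S' ⊆ A) (U₁ U₂ : Set X) (y₁ y₂ : X) (h₁ : U₁ ∩ A ⊆ {y₁}) (h₂ : U₂ ∩ A ⊆ {y₂})
    (hne : y₁ ≠ y₂) : f ⁻¹' U₁ ∩ f ⁻¹' U₂ ⊆ S'ᶜ := by
  rintro x ⟨hx₁, hx₂⟩ hxS
  have hA : f x ∈ A := hS ⟨x, hxS, rfl⟩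
  have e₁ : f x = y₁ := h₁ ⟨hx₁, hA⟩
  have e₂ : f x = y₂ := h₂ ⟨hx₂, hA⟩
  exact hne (e₁.symm.trans e₂)

end Summit.ResolutionOfSingularities.ResolutionOfSingularities.Theorems.SigmaMaxModificationsCorridor3.TameWild

end
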